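/-
Copyright: lit-balaban Phase-2 proof seat p08 (gen 8).  Statement-level skeleton of a published paper; no proof claims beyond what
the kernel checks below.
-/
import Literature.MathematicalPhysics.QuantumFieldTheory.BalabanImbrieJaffe1984to88.BIJ88Decay216Native
import Literature.MathematicalPhysics.QuantumFieldTheory.BalabanImbrieJaffe1984to88.BIJ85Ineq723TorusCE

/-!
# `BalabanImbrieJaffe1984to88.BIJ88Decay216Prop12` — T. Bałaban, J. Imbrie, A. Jaffe, *Effective action and cluster properties of the
abelian Higgs model*, Commun. Math. Phys. **114** (1988) 257–315 [BalabanImbrieJaffe1988]: **(2.16), (2.17), (2.18), (2.19)** pp. 261–262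
ON THE TORI OF THE SERIES FOR THE `σ_k` OF RECORD (p30's `sigmaTorus hd η^d η⁻¹ k`), **GIVEN ONLY [6I] PROPOSITION 1.2 BY ITS TREE NAME**
(`B5.Prop12Printed` for p09's torus family of scales `levStd`): the last displayed [I]-input of the gen-7/gen-8 torus files — [I] (7.2.3)
*"|C^{(k)}_{μν}(x,y)| ≦ Me^{−δ|x−y|} for x, y ∈ T₁^{(k)}"* for the UNIT-LATTICE propagators `C^{(j)} = CE P η_j^d L^j j` — is DISCHARGED
by seat p09's hypothesis-free theorem `BIJ85Ineq723TorusCE.ineq723_CE_lt` ((M_C, δ_C) depending on `(d, L)` only; scales `j < k ≤ m + K`,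
which are exactly the uses of r18's `BIJ88Decay216Native.decay216_native_eta`)

statement-level skeleton of published theorems with citation tags; proofs where landed; nothing here is a claim about the Yang–Mills mass gap

PDF held: `paper:balaban1988-cmp114-bij-abelian-higgs-effective-action` (journal page = PDF page + 256), p. 261 [PDF 5], p. 262 [PDF 6]
(text layer `~/.lit/texts/paper-balaban1988-cmp114-bij-abelian-higgs-effective-action/p0005.txt`, `p0006.txt`, re-read this session);
[I] = [BalabanImbrieJaffe1985] (`paper:balaban1985-cmp97-bij-higgs-minimizers`), p. 325 (7.2.2)/(7.2.3); [6I] = [Balaban1984PropagatorsI]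
Prop. 1.2 (tree name `Balaban1983to89.B5.Prop12Printed`).

CITATION HEADER (lean-in-tree rule).  Part of the lit-balaban TYPED SKELETON (HOME `run/shared/lean/pub/lit-balaban/`), Phase-2 proof
seat p08 (gen 8), unit `lit-balaban-p08`; WHAT IS REPRODUCED = SKELETON rows **C2.Eq2.16**, **C2.Eq2.17**, **C2.Eq2.18**, **C2.Eq2.19**
(reader file `HOME/lit-balaban-r18/ROWS-C2.md`, owner r18, referee ref-5; heads `proved` — p264361 + p265099 (r18 g8), p261051 + p262770 +
p258391 + p254138 + p253816 + p253429 (p08 g6–g7)), kind «model instance, displayed input retired»: the rows' torus theorems of record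
take (7.2.3) as a hypothesis on the native unit-lattice matrices (`∀ j ≤ m + K` in `decay216_native_of_prop12` /
`ineq217_native_of_prop12` / `close218_native_of_prop12` / `ineq219_native_of_prop12`); row **C1.Eq7.2.3** (owner r15) is now PROVED
on the tori with no hypothesis (p09 g6: p263206 `BIJ85Ineq723TorusCornerGauge`, p265367 `BIJ85Ineq723Torus`, p266116
`BIJ85Ineq723TorusCE`), in the binder shape `∀ k ≤ m + K, ∀ j < k` (the top scale `j = m + K` has no block structure and is never used).
This file re-runs r18's three assemblies with that weaker binder and feeds them p09's theorem, so that the ONLY remaining hypothesis of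
(2.16)–(2.19) on the tori is `B5.Prop12Printed` — the [6I] content of row C1.Eq7.2.1-7.2.2 (*"This inequality is a consequence of
Proposition 1.2 and the representation (1.103) of [6I]"*), typed in its own block (rows B5.Prop1.2 / B5.Eq1.103).  TAKING line
HOME/STATUS.md 2026-08-21T18:13:52Z.  Decls used BY NAME (nothing restated): r18's `BIJ88Decay216Native.decay216_native_eta`; p09's
`BIJ85Ineq723TorusCE.ineq723_CE_lt`, `BIJ85Ineq722DeltaA.ineq722_deltaA_of_prop12Printed`, `torusKernelData`, `levStd`; p08's (gens 6–7)
`BIJ88Ineq217Ineq722Torus.exists_bound_of_ineq722` / `abs_ineq217_ineq722_torus`, `BIJ88Decay216Torus.sum_plaq_exp_neg_pdist_le`,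
`BIJ88Ineq219TorusProp12.close_trunc_of_decay3` / `ineq219_sigmaKernel_eta` / `ineq219_mono`; p02's `BIJ88Close218Proof.ineq219_of_close`;
p10's `BIJ85SigmaClosedCube.c711`; r15's typed `BIJ85Sect7Statements.KernelData.Ineq722`; r18's typed `BIJ88Sect2Statements.Ineq219` /
`Close` / `trunc`.

THE PRINTED TEXT (p. 261 [PDF 5] – p. 262 [PDF 6], verbatim): *"Writing 𝒟_k in hierarchical form as in (2.12) and using the regularity
of H_j, 𝒟_j, j < k, we see that |σ_k(p₁,p₂)| ≦ ce^{−c dist(p₁,p₂)} for dist(p₁,p₂) ≧ c. (2.16) [The rapid decay of the terms with small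
j compensates for the scaling factors (L^jη)^{−1}.] … Then we prove that |(σ_kf^{(k)})(p₁)| ≦ ‖f^{(k)}‖_∞ c (2.17) as follows. Write
f^{(k)} = ∂□A + f′, where □ is the characteristic function of a neighborhood of p₂. The distant part (σ_kf′)(p₁) is easily estimated by
‖f^{(k)}‖_∞ by (2.16). The near part is similarly bounded since σ_k is a bounded operator on curls [2]. It was also shown in [2] that σ_k
is bounded from below. In view of (2.16) we have that |σ_{k,loc}(p₁,p₂) − σ_k(p₁,p₂)| ≦ e^{−cr(e_k)}e^{−c dist(p₁,p₂)}, (2.18) so that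
(2.16), (2.17) hold for σ_{k,loc}, and σ_{k,loc} ≧ c > 0 (2.19) as well."*; [I] p. 325: *"The unit lattice propagator C^{(k)} also has
exponential decay, |C^{(k)}_{μν}(x,y)| ≦ Me^{−δ|x−y|}, (7.2.3) for x, y ∈ T₁^{(k)}."*

THE TORUS DATA (all in the tree): tori `Balaban1983to89.Setup`/`Params` (`d ≥ 2`, block size `L`, `K` steps done, `m` to go; standing
range `k ≤ m + K`; `η = η_k = L^{−k}`), unit plaquettes `TPlaq P k` with the `ℓ¹` torus distance `pdist`, p30's
`σ_k = sigmaTorus hd (η_k^d) (L^k) k` ((4.2.2) at the printed normalisation `Q^e_kQ^{e*}_k = η^{−2}`), its kernel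
`σ_k(p₁,p₂) = (σ_k e_{p₂})(p₁)` with `e_{p₂} = toU P k (Pi.single p₂ 1)`, the (2.14)-truncation `trunc pdist R σ_k`, the Landau
minimizers `H_j` of p09's `torusRep P j (deltaAData …)` ((1.103) representation, scales `levStd P i = min i (m + K)`), the unit-lattice
propagators `C^{(j)} = CE P η_j^d L^j j` of p11 ((4.3.3), native weights), `c711 d` = [I] Thm. 7.1.1's constant on the closed cube.

WHAT IS PROVED (0 `sorry`, standard axioms; theorems only — proof lane; every `d ≥ 2`):
* §1 **(2.16)** `decay216_torus_of_ineq722_lt` (r18's `decay216_native_of_ineq722` with the (7.2.3) input in the WEAKER binder shape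
  `∀ k ≤ m + K, ∀ j < k` — the shape p09 serves), **`decay216_torus_prop12`**: `∃ R₀ c₀ δ′, 0 < δ′ ∧ 0 ≤ c₀ ∧ ∀ k ≤ m + K, ∀ p₁ p₂,
  R₀ ≤ pdist p₁ p₂ → |σ_k(p₁,p₂)| ≤ c₀e^{−δ′·pdist p₁ p₂}` — ONE triple for all scales of the torus — from `B5.Prop12Printed` ALONE.
* §2 **(2.17)** **`ineq217_torus_prop12`**: `∃ R₀, C ≥ 0, ∀ k ≤ m + K, ∀ R ≥ R₀` with `2R < |T^{(k)}|` per direction, for every `p₁` and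
  every `f` that is a curl `∂A` on the box of radius `R` about `p₁`: `|(σ_kf)(p₁)| ≤ C(1 + R)‖f‖_∞` — from `B5.Prop12Printed` ALONE.
* §3 **(2.18)** **`close218_torus_prop12`** (`Close pdist σ_{k,loc} σ_k (c₀e^{−(δ′/2)R}) (δ′/2)` for every `k ≤ m + K`, `R ≥ R₀`) and
  **(2.19)** **`ineq219_torus_prop12`** (`∃ R₁ ∀ k ≤ m + K ∀ R ≥ R₁, Ineq219 σ_{k,loc} (c711 d)`) — from `B5.Prop12Printed` ALONE;
  `sect2_sigma_torus_prop12` bundles §1–§3 in one existential statement.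
HONEST SCOPE.  (i) The one remaining hypothesis is [6I] Proposition 1.2 BY NAME for the torus settings `settingOf (torusRep P (levStd P i)
(deltaAData …)) i` (exactly the `h12` of rows C1.Eq7.2.1-7.2.2 / C2.Eq2.16's files); its constants, hence `(R₀, c₀, δ′, C, R₁)`, are
existential PER TORUS `P` as in every file of the lane (uniform in the scale `k ≤ m + K`; p09's (7.2.3) constants are uniform in the
volume too).  (ii) Thresholds restated in `pdist`; constants explicit where r18's are, not optimal; the (2.17) assembly needs
`2R < sitesPerDir k` (inherited).  (iii) `U = 1`, real abelian fields, torus (periodic b.c.), standing range; the printed `e^{−cr(e_k)}` of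
(2.18) is the `e^{−(δ′/2)R}` at the printed radius `R = (1/2L)r(e_{k−1})` (row C2.Eq2.14), any `R ≥ R₀` here.  (iv) No `def`, no new named
fact, nothing restated; NOT summit progress.  Unit `lit-balaban-p08` (literature-prover-lit-balaban-p08-g8-0), 2026-08-21.
-/

open scoped BigOperators RealInnerProductSpace

namespace Literature.MathematicalPhysics.QuantumFieldTheory.BalabanImbrieJaffe1984to88.BIJ88Decay216Prop12

open Balaban1983to89 hiding Site Plaq
open Balaban1983to89.LatticeFieldCalculus
open Balaban1983to89.T4AxialGaugeSmallField (castSite boxPlaqs)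
open BIJ88Ineq217Ineq722Torus BIJ88Ineq217NearPart BIJ88Decay216Torus
open BIJ88Sect2Statements (supNorm)
open BIJ88Close235Proof (supNorm_nonneg)
open BIJ85Prop521Torus BIJ85Sigma421Torus BIJ85Prop522Torus
open BIJ85Sect7Statements BIJ85Ineq722Torus BIJ85Eq721MinimizerKernel
open BIJ85Ineq722ProofPart2 (settingOf)
open BIJ85Ineq722DeltaA (deltaAData ineq722_deltaA_of_prop12Printed)
open BIJ88Sect2Statements (Ineq219 Close trunc)
open BIJ88Close218Proof (ineq219_of_close)
open BIJ88Ineq219SigmaTorus (pdist_comm)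
open BIJ88Ineq219TorusProp12 (ineq219_sigmaKernel_eta ineq219_mono close_trunc_of_decay3)
open BIJ85SigmaClosedCube (c711 c711_pos)
open BIJ88Decay216Native (decay216_native_eta)
open BIJ85Ineq723TorusCE (ineq723_CE_lt)

open Balaban1983to89 renaming Site → TSite, Plaq → TPlaq

noncomputable section

variable {P : Params}

/-! ## §1  (2.16) on the tori given only [6I] Proposition 1.2 -/

/-- **(2.16) ON THE TORI FROM THE TYPED (7.2.2) AND (7.2.3) IN THE BINDER SHAPE `∀ k ≤ m + K, ∀ j < k`** (the shape p09's
`ineq723_CE_lt` serves): r18's `decay216_native_of_ineq722` re-run — `∃ R₀ c₀ δ′` such that for EVERY `k ≤ m + K` the kernel of p30's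
`σ_k` (printed normalisation) satisfies `|σ_k(p₁,p₂)| ≤ c₀e^{−δ′·pdist p₁ p₂}` whenever `pdist p₁ p₂ ≥ R₀`.
[cite: BalabanImbrieJaffe1988, (2.16) p.261] -/
theorem decay216_torus_of_ineq722_lt (hd : 2 ≤ P.d) {lev : ℕ → ℕ} (hlev : ∀ i, lev i ≤ P.m + P.K)
    (hcov : ∀ j ≤ P.m + P.K, ∃ i, lev i = j) {a : ℝ} (ha : 0 < a) {BondU : ℕ → Type}
    {distEB : (i : ℕ) → TSite P 0 → BondU i → ℝ} {Cker : (i : ℕ) → Fin P.d → Fin P.d → TSite P (lev i) → TSite P (lev i) → ℝ}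
    {Dker : (i : ℕ) → TSite P 0 → BondU i → ℝ}
    (h722 : KernelData.Ineq722
      (fun i => torusKernelData P (lev i) (deltaAData (hlev i) a) (BondU i) (distEB i) (Cker i) (Dker i)))
    {δC MC : ℝ} (hδC : 0 < δC) (hMC : 0 ≤ MC)
    (hC : ∀ k ≤ P.m + P.K, ∀ j < k, ∀ b b' : PBond P j, |⟪toEj P j (Pi.single b 1),
      CE P ((P.eta j) ^ P.d) ((P.L : ℝ) ^ j) j (toEj P j (Pi.single b' 1))⟫| ≤ MC * Real.exp (-(δC * (supDist b.src b'.src : ℝ)))) :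
    ∃ R₀ c₀ δ' : ℝ, 0 < δ' ∧ 0 ≤ c₀ ∧ ∀ (k : ℕ) (hk : k ≤ P.m + P.K) (p₁ p₂ : TPlaq P k), R₀ ≤ pdist p₁ p₂ →
        |sigmaTorus (P := P) hd ((P.eta k) ^ P.d) ((P.L : ℝ) ^ k) k (toU P k (Pi.single p₂ 1)) p₁| ≤
          c₀ * Real.exp (-δ' * pdist p₁ p₂) := by
  obtain ⟨δ, M, hδ, hM, hBall⟩ := exists_bound_of_ineq722 hlev h722
  have hd0 : (0 : ℝ) < P.d := by exact_mod_cast P.hd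
  have ha₀ : 0 < min δ δC / 2 := half_pos (lt_min hδ hδC)
  refine ⟨(P.d : ℝ) * (4 * δ / (min δ δC / 2) + 2),
    4 * M ^ 2 * MC * ((P.d : ℝ) ^ 2 * (Real.exp (min δ δC / 2 / 2) * ((2 * (1 + P.d / (min δ δC / 2))) ^ P.d) ^ 2)) *
      (((P.d + 1).factorial : ℝ) / (min δ δC / 2) ^ (P.d + 1)),
    min δ δC / 2 / 2 / P.d, by positivity, by positivity, fun k hk p₁ p₂ hfar => ?_⟩
  refine decay216_native_eta hd hk ha hδ hδC hMC (fun j hj hjk μ ν x y => ?_) (fun j hjk => hC k hk j hjk) p₁ p₂ hfar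
  obtain ⟨i, hi⟩ := hcov j hj
  subst hi
  have h := hBall i μ ν x y
  rw [torusKernelData_gradH] at h
  exact (le_add_of_nonneg_left (abs_nonneg _)).trans h

/-- **(7.2.3) FOR THE NATIVE UNIT-LATTICE MATRICES ON THIS TORUS, NO HYPOTHESIS** — p09's `ineq723_CE_lt` read at `(d, L) := (P.d, P.L)`
and the ambient decidable equality: `∃ M_C > 0, δ_C > 0, ∀ k ≤ m + K, ∀ j < k, ∀ b b′, |⟨e_b, C^{(j)}e_{b′}⟩| ≤ M_C e^{−δ_C|b₋ − b′₋|_∞}`.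
[cite: BalabanImbrieJaffe1985, (7.2.3) p.325] -/
theorem ineq723_CE_torus (hd : 2 ≤ P.d) :
    ∃ MC δC : ℝ, 0 < MC ∧ 0 < δC ∧ ∀ k ≤ P.m + P.K, ∀ j < k, ∀ b b' : PBond P j, |⟪toEj P j (Pi.single b 1),
      CE P ((P.eta j) ^ P.d) ((P.L : ℝ) ^ j) j (toEj P j (Pi.single b' 1))⟫| ≤ MC * Real.exp (-(δC * (supDist b.src b'.src : ℝ))) := by
  obtain ⟨MC, δC, hMC, hδC, H⟩ := ineq723_CE_lt P.d P.L hd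
  exact ⟨MC, δC, hMC, hδC, fun k hk j hjk b b' => H P rfl rfl k hk j _ hjk b b'⟩

/-- **(2.16) ON THE TORI GIVEN ONLY [6I] PROPOSITION 1.2 BY ITS TREE NAME** (`B5.Prop12Printed` for p09's torus family of scales
`levStd`, the hypothesis of row C1.Eq7.2.1-7.2.2's own files): `∃ R₀ c₀ δ′, 0 < δ′ ∧ 0 ≤ c₀ ∧` for EVERY `k ≤ m + K` and all unit
plaquettes with `pdist p₁ p₂ ≥ R₀`, `|σ_k(p₁,p₂)| ≤ c₀e^{−δ′·pdist p₁ p₂}` for p30's `σ_k = sigmaTorus hd η_k^d L^k k` — the (7.2.2)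
input via `ineq722_deltaA_of_prop12Printed`, the (7.2.3) input DISCHARGED by `ineq723_CE_torus`; every `d ≥ 2`, constants independent of
`k`. [cite: BalabanImbrieJaffe1988, (2.16) p.261] -/
theorem decay216_torus_prop12 (hd : 2 ≤ P.d) {a : ℝ} (ha : 0 < a)
    (h12 : B5.Prop12Printed (fun i => settingOf (torusRep P (levStd P i) (deltaAData (levStd_le i) a)) i)) :
    ∃ R₀ c₀ δ' : ℝ, 0 < δ' ∧ 0 ≤ c₀ ∧ ∀ (k : ℕ) (hk : k ≤ P.m + P.K) (p₁ p₂ : TPlaq P k), R₀ ≤ pdist p₁ p₂ →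
        |sigmaTorus (P := P) hd ((P.eta k) ^ P.d) ((P.L : ℝ) ^ k) k (toU P k (Pi.single p₂ 1)) p₁| ≤
          c₀ * Real.exp (-δ' * pdist p₁ p₂) := by
  obtain ⟨MC, δC, hMC, hδC, hC⟩ := ineq723_CE_torus (P := P) hd
  exact decay216_torus_of_ineq722_lt hd levStd_le (fun j hj => ⟨j, min_eq_left hj⟩) ha
    (ineq722_deltaA_of_prop12Printed (levStd P) levStd_le ha (fun _ => PUnit) (fun _ _ _ => 0) (fun _ _ _ _ _ => 0)
      (fun _ _ _ => 0) h12) hδC hMC.le hC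

/-! ## §2  (2.17) on the tori given only [6I] Proposition 1.2 -/

/-- **(2.17) ON THE TORI GIVEN ONLY [6I] PROPOSITION 1.2 BY ITS TREE NAME**: there are `R₀` and `C ≥ 0` such that at every scale
`k ≤ m + K`, for every radius `R ≥ R₀` with `2R < |T^{(k)}|` per direction, every `p₁` (`p₁.src = castSite z₁`) and every `f` that is
a curl `∂A` on the box of radius `R` about `p₁`: `|(σ_kf)(p₁)| ≤ C(1 + R)·‖f‖_∞` for p30's `σ_k = sigmaTorus hd η^d η⁻¹ k` — p08's
`abs_ineq217_ineq722_torus` (the p. 262 argument: near part *"σ_k is a bounded operator on curls"* through (7.2.1)–(7.2.2), distant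
part by (2.16)) fed with §1; both the (7.2.2) and the (2.16) inputs now rest on `B5.Prop12Printed` alone.
[cite: BalabanImbrieJaffe1988, (2.17) p.262] -/
theorem ineq217_torus_prop12 (hd : 2 ≤ P.d) {a : ℝ} (ha : 0 < a)
    (h12 : B5.Prop12Printed (fun i => settingOf (torusRep P (levStd P i) (deltaAData (levStd_le i) a)) i)) :
    ∃ R₀ C : ℝ, 0 ≤ C ∧ ∀ (k : ℕ) (hk : k ≤ P.m + P.K) (R : ℕ), R₀ ≤ R → 2 * R < P.sitesPerDir k →
      ∀ (p₁ : TPlaq P k) (z₁ : Fin P.d → ℤ), p₁.src = castSite z₁ →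
      ∀ (f : TPlaq P k → ℝ) (A : VecField P k ℝ), (∀ p ∈ boxPlaqs (loOf z₁ R) (hiOf z₁ R), f p = curl 1 A p) →
        |sigmaTorus (P := P) hd ((P.eta k) ^ P.d) ((P.L : ℝ) ^ k) k (toU P k f) p₁| ≤ C * (1 + R) * supNorm f := by
  have h722 := ineq722_deltaA_of_prop12Printed (levStd P) levStd_le ha (fun _ => PUnit) (fun _ _ _ => 0)
    (fun _ _ _ _ _ => 0) (fun _ _ _ => 0) h12
  have hcov : ∀ j ≤ P.m + P.K, ∃ i, levStd P i = j := fun j hj => ⟨j, min_eq_left hj⟩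
  obtain ⟨MC, δC, hMC, hδC, hC⟩ := ineq723_CE_torus (P := P) hd
  obtain ⟨C₁, hC₁, h217⟩ := abs_ineq217_ineq722_torus hd levStd_le ha h722
  obtain ⟨R₀, c₀, δ', hδ', hc₀, h216⟩ := decay216_torus_of_ineq722_lt hd levStd_le hcov ha h722 hδC hMC.le hC
  set S : ℝ := (P.d : ℝ) ^ 2 * (2 * (1 + δ'⁻¹)) ^ P.d with hS
  have hS0 : 0 ≤ S := by positivity
  have hd1 : (0 : ℝ) ≤ ((P.d - 1 : ℕ) : ℝ) := Nat.cast_nonneg _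
  refine ⟨R₀, 2 * C₁ * ((P.d - 1 : ℕ) : ℝ) + c₀ * S * (1 + 8 * ((P.d - 1 : ℕ) : ℝ)), by positivity, ?_⟩
  intro k hk R hR0 hR p₁ z₁ h₁ f A hf
  obtain ⟨i, hi⟩ := hcov k hk
  subst hi
  have main := h217 i c₀ δ' S hc₀ R hR p₁ z₁ h₁ (fun p₂ hp => h216 (levStd P i) hk p₁ p₂ (hR0.trans hp))
    (sum_plaq_exp_neg_pdist_le hδ' p₁) f A hf
  refine main.trans (mul_le_mul_of_nonneg_right ?_ (supNorm_nonneg f))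
  have hR' : (0 : ℝ) ≤ R := Nat.cast_nonneg _
  push_cast
  nlinarith [mul_nonneg hC₁ hd1, mul_nonneg (mul_nonneg hc₀ hS0) hd1, mul_nonneg hC₁ (mul_nonneg hd1 hR'),
    mul_nonneg (mul_nonneg hc₀ hS0) hR']

/-! ## §3  (2.18)–(2.19) on the tori given only [6I] Proposition 1.2 -/

/-- `c₀Se^{−(δ′/2)R} ≤ γ` for `R ≥ max(1, 2c₀S/(δ′γ))` (`e^{−y} ≤ 1/y`; p08 g7 / r18 g8 private lemma, re-proved). [folklore] -/
private theorem small_of_large {c₀ S δ' γ R : ℝ} (hc₀ : 0 ≤ c₀) (hS : 0 ≤ S) (hδ' : 0 < δ') (hγ : 0 < γ) (hR1 : 1 ≤ R)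
    (hR : 2 * (c₀ * S) / (δ' * γ) ≤ R) : c₀ * Real.exp (-(δ' / 2) * R) * S ≤ γ := by
  have hy : 0 < δ' / 2 * R := by positivity
  have hexp : Real.exp (-(δ' / 2) * R) ≤ 1 / (δ' / 2 * R) := by
    rw [neg_mul, Real.exp_neg, one_div]
    exact inv_anti₀ hy ((by linarith : δ' / 2 * R ≤ δ' / 2 * R + 1).trans (Real.add_one_le_exp _))
  have h1 : c₀ * Real.exp (-(δ' / 2) * R) * S ≤ c₀ * (1 / (δ' / 2 * R)) * S :=
    mul_le_mul_of_nonneg_right (mul_le_mul_of_nonneg_left hexp hc₀) hS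
  refine h1.trans ?_
  rw [div_le_iff₀ (by positivity)] at hR
  rw [mul_one_div, div_mul_eq_mul_div, div_le_iff₀ hy]
  nlinarith

/-- **(2.18) ON THE TORI GIVEN ONLY [6I] PROPOSITION 1.2 BY ITS TREE NAME**: `∃ R₀, c₀ ≥ 0, δ′ > 0` such that for EVERY `k ≤ m + K`
and every `R ≥ R₀`, `Close pdist σ_{k,loc} σ_k (c₀e^{−(δ′/2)R}) (δ′/2)` for the kernel of `sigmaTorus hd η^d η⁻¹ k` and its
(2.14)-truncation at radius `R` (§1's `decay216_torus_prop12` into p08's `close_trunc_of_decay3`) — *"In view of (2.16) we have that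
|σ_{k,loc}(p₁,p₂) − σ_k(p₁,p₂)| ≦ e^{−cr(e_k)}e^{−c dist(p₁,p₂)}"*. [cite: BalabanImbrieJaffe1988, (2.18) p.262] -/
theorem close218_torus_prop12 (hd : 2 ≤ P.d) {a : ℝ} (ha : 0 < a)
    (h12 : B5.Prop12Printed (fun i => settingOf (torusRep P (levStd P i) (deltaAData (levStd_le i) a)) i)) :
    ∃ R₀ c₀ δ' : ℝ, 0 < δ' ∧ 0 ≤ c₀ ∧ ∀ (k : ℕ) (hk : k ≤ P.m + P.K) (R : ℝ), R₀ ≤ R →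
        Close pdist (trunc pdist R fun p q => sigmaTorus (P := P) hd ((P.eta k) ^ P.d) ((P.L : ℝ) ^ k) k (toU P k (Pi.single q 1)) p)
          (fun p q => sigmaTorus (P := P) hd ((P.eta k) ^ P.d) ((P.L : ℝ) ^ k) k (toU P k (Pi.single q 1)) p)
          (c₀ * Real.exp (-(δ' / 2) * R)) (δ' / 2) := by
  obtain ⟨R₀, c₀, δ', hδ', hc₀, h216⟩ := decay216_torus_prop12 hd ha h12
  exact ⟨R₀, c₀, δ', hδ', hc₀, fun k hk R hR => close_trunc_of_decay3 hc₀ hδ'.le hR (h216 k hk)⟩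

/-- **(2.19) ON THE TORI GIVEN ONLY [6I] PROPOSITION 1.2 BY ITS TREE NAME — «σ_{k,loc} ≧ c > 0» FOR `r(e_k)` LARGE, ONE RADIUS FOR ALL
SCALES, every `d ≥ 2`**: `∃ R₁` such that for EVERY `k ≤ m + K` and every truncation radius `R ≥ R₁`, r18's `Ineq219 σ_{k,loc} (c711 d)`
holds for the (2.14)-truncation of the kernel of `sigmaTorus hd η^d η⁻¹ k` — [I] Thm. 7.1.1 at the physical weight (p08's
`ineq219_sigmaKernel_eta`, constant `2c711(d)`), the closeness `close218_torus_prop12`, p02's `ineq219_of_close` with the plaquette row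
sums, and `c₀e^{−(δ′/2)R}·d²(2(1 + (δ′/2)⁻¹))^d ≤ c711(d)` for `R ≥ R₁`. [cite: BalabanImbrieJaffe1988, (2.19) p.262] -/
theorem ineq219_torus_prop12 (hd : 2 ≤ P.d) {a : ℝ} (ha : 0 < a)
    (h12 : B5.Prop12Printed (fun i => settingOf (torusRep P (levStd P i) (deltaAData (levStd_le i) a)) i)) :
    ∃ R₁ : ℝ, ∀ (k : ℕ) (hk : k ≤ P.m + P.K) (R : ℝ), R₁ ≤ R →
        Ineq219 (trunc pdist R fun p q => sigmaTorus (P := P) hd ((P.eta k) ^ P.d) ((P.L : ℝ) ^ k) k (toU P k (Pi.single q 1)) p)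
          (c711 P.d) := by
  obtain ⟨R₀, c₀, δ', hδ', hc₀, h218⟩ := close218_torus_prop12 hd ha h12
  have hd0 : 0 < P.d := by have := P.hd; omega
  have hγ : 0 < c711 P.d := c711_pos hd0
  set S : ℝ := (P.d : ℝ) ^ 2 * (2 * (1 + (δ' / 2)⁻¹)) ^ P.d with hS
  have hS0 : 0 ≤ S := by positivity
  refine ⟨max R₀ (max 1 (2 * (c₀ * S) / (δ' * c711 P.d))), fun k hk R hR => ?_⟩
  have hR0 : R₀ ≤ R := (le_max_left _ _).trans hR
  have hR1 : 1 ≤ R := ((le_max_left _ _).trans (le_max_right _ _)).trans hR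
  have hR2 : 2 * (c₀ * S) / (δ' * c711 P.d) ≤ R := ((le_max_right _ _).trans (le_max_right _ _)).trans hR
  have hsmall' : c₀ * Real.exp (-(δ' / 2) * R) * S ≤ c711 P.d := small_of_large hc₀ hS0 hδ' hγ hR1 hR2
  have hL : ((P.L : ℝ) ^ k) ≠ 0 := pow_ne_zero _ P.cast_L_pos.ne'
  have h := ineq219_of_close (ineq219_sigmaKernel_eta hd hk hL) (h218 k hk R hR0) pdist_comm
    (fun p₁ => sum_plaq_exp_neg_pdist_le (half_pos hδ') p₁) (by positivity) (by linarith)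
  exact ineq219_mono h hγ (by linarith)

/-- **C2 SECT. 2's σ_k PARAGRAPH ON THE TORI, GIVEN ONLY [6I] PROPOSITION 1.2** — (2.16), (2.17), (2.18), (2.19) bundled: one set of
constants `(R₀, c₀, δ′, C, R₁)` for all scales `k ≤ m + K` of the torus such that (2.16) the kernel of `σ_k` decays as
`c₀e^{−δ′·pdist}` beyond `R₀`, (2.17) `|(σ_kf)(p₁)| ≤ C(1 + R)‖f‖_∞` for `f` a curl on the `R`-box about `p₁` (`R₀ ≤ R`,
`2R < |T^{(k)}|`), (2.18) `σ_{k,loc}` (truncation at any `R ≥ R₀`) is `c₀e^{−(δ′/2)R}e^{−(δ′/2)pdist}`-close to `σ_k`, and (2.19)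
`σ_{k,loc} ≥ c711(d) > 0` in r18's `Ineq219` sense for every truncation radius `R ≥ R₁`. [cite: BalabanImbrieJaffe1988, (2.16)–(2.19) pp.261–262] -/
theorem sect2_sigma_torus_prop12 (hd : 2 ≤ P.d) {a : ℝ} (ha : 0 < a)
    (h12 : B5.Prop12Printed (fun i => settingOf (torusRep P (levStd P i) (deltaAData (levStd_le i) a)) i)) :
    ∃ R₀ c₀ δ' C R₁ : ℝ, 0 < δ' ∧ 0 ≤ c₀ ∧ 0 ≤ C ∧ 0 < c711 P.d ∧
      (∀ (k : ℕ) (hk : k ≤ P.m + P.K) (p₁ p₂ : TPlaq P k), R₀ ≤ pdist p₁ p₂ →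
        |sigmaTorus (P := P) hd ((P.eta k) ^ P.d) ((P.L : ℝ) ^ k) k (toU P k (Pi.single p₂ 1)) p₁| ≤
          c₀ * Real.exp (-δ' * pdist p₁ p₂)) ∧
      (∀ (k : ℕ) (hk : k ≤ P.m + P.K) (R : ℕ), R₀ ≤ R → 2 * R < P.sitesPerDir k →
        ∀ (p₁ : TPlaq P k) (z₁ : Fin P.d → ℤ), p₁.src = castSite z₁ →
        ∀ (f : TPlaq P k → ℝ) (A : VecField P k ℝ), (∀ p ∈ boxPlaqs (loOf z₁ R) (hiOf z₁ R), f p = curl 1 A p) →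
          |sigmaTorus (P := P) hd ((P.eta k) ^ P.d) ((P.L : ℝ) ^ k) k (toU P k f) p₁| ≤ C * (1 + R) * supNorm f) ∧
      (∀ (k : ℕ) (hk : k ≤ P.m + P.K) (R : ℝ), R₀ ≤ R →
        Close pdist (trunc pdist R fun p q => sigmaTorus (P := P) hd ((P.eta k) ^ P.d) ((P.L : ℝ) ^ k) k (toU P k (Pi.single q 1)) p)
          (fun p q => sigmaTorus (P := P) hd ((P.eta k) ^ P.d) ((P.L : ℝ) ^ k) k (toU P k (Pi.single q 1)) p)
          (c₀ * Real.exp (-(δ' / 2) * R)) (δ' / 2)) ∧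
      (∀ (k : ℕ) (hk : k ≤ P.m + P.K) (R : ℝ), R₁ ≤ R →
        Ineq219 (trunc pdist R fun p q => sigmaTorus (P := P) hd ((P.eta k) ^ P.d) ((P.L : ℝ) ^ k) k (toU P k (Pi.single q 1)) p)
          (c711 P.d)) := by
  obtain ⟨R₀, c₀, δ', hδ', hc₀, h216⟩ := decay216_torus_prop12 hd ha h12
  obtain ⟨R₀', C, hC, h217⟩ := ineq217_torus_prop12 hd ha h12
  obtain ⟨R₁, h219⟩ := ineq219_torus_prop12 hd ha h12
  have hd0 : 0 < P.d := by have := P.hd; omega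
  refine ⟨max R₀ R₀', c₀, δ', C, R₁, hδ', hc₀, hC, c711_pos hd0, fun k hk p₁ p₂ hp => h216 k hk p₁ p₂ ((le_max_left _ _).trans hp),
    fun k hk R hR => h217 k hk R ((le_max_right _ _).trans hR),
    fun k hk R hR => close_trunc_of_decay3 hc₀ hδ'.le ((le_max_left _ _).trans hR) (h216 k hk), h219⟩

end

end Literature.MathematicalPhysics.QuantumFieldTheory.BalabanImbrieJaffe1984to88.BIJ88Decay216Prop12
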